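import Mathlib
import Literature.Probability.Percolation.PercolationProofs
import Literature.Probability.LatticeModels.ProdBernoulliIndependence
import Literature.Probability.LatticeModels.ProdBernoulliClusterLocality
import Literature.Probability.LatticeModels.ProdBernoulliCoupling
import Literature.Probability.Percolation.KozmaNitzanPinning
import Summits.CriticalPhenomena.PercolationContinuityZ3.Theorems.PercNearOneGluingAdditiveGluingSigmaGeometry
import Summits.CriticalPhenomena.PercolationContinuityZ3.Theorems.PercNearOneGluingAdditiveGluingSigmaLaw
import Summits.CriticalPhenomena.PercolationContinuityZ3.Theorems.PercNearOneGluingAdditiveGluingSigmaRecursion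
import Summits.CriticalPhenomena.PercolationContinuityZ3.Theorems.PercNearOneGluingAdditiveGluingGoodStep24LowOnly
import HarnessLib

/-! # Crux `PercNearOneGluing.AdditiveGluing` (stmt-CriticalPhenomena-4576), line `subuniform-dead-pocket-maximum`, stub `stub_goodStep` — the σ-engine at a low-only observer (siege k24)

Support file for the inductive step `stub_goodStep`; proves the registered helper stub
`stub_goodStepEngine_k24` and lands `--supports stmt-CriticalPhenomena-4576`.

## Content ("explicit two-point closed form through the star of `o`, then bootstrap")

Let `b ∈ A ∌ o` and suppose every pair `o–a`, `a ∈ A`, has weight `0` (a LOW-ONLY observer; the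
general observer is reduced to this one by `stub_goodStepLowOnly_k24`).  Decompose by the open
star of `o`: the LAYER `S = {y | o–y open}` (KN's `σ_S`).  Conditionally on the layer, every
connection not through `o` is percolation on the branch graph
`G⁰/S := (w with the star of o killed) with S glued` (`stub_sigmaLaw` + `stub_sigmaGeometry`,
block `O = {o}`), and
* `μ_w(o ↔ b) = Σ_S μ_w(σ_S) · μ_{G⁰/S}(S ↔ b)`,
* `μ_w(a ↔ b) = Σ_S μ_w(σ_S) · μ_{G⁰/S}(a ↔ b)` for `a ≠ o` — the two-point function of `G` in
  closed form through the star,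
* `μ_w(C(o) = W) = Σ_S μ_w(σ_S) · μ_{G⁰/S}(C(S) ∪ {o} = W)`.
Hence (**`stub_goodStepEngine_k24`**): if for every possible layer `S` (`o ∉ S`, `S ∩ A = ∅`, all
pairs `o–S` of positive weight) the branch graph satisfies the GLUED GOODNESS inequality with a
fixed relay `a₀ ∈ A`,
`μ_{G⁰/S}(a₀ ↔ b) ≤ μ_{G⁰/S}(S ↔ b) + Σ_{W ∋ o dead} μ_{G⁰/S}(C(S) ∪ {o} = W) · μ_w(sel W ↔ b in Wᶜ)`,
then `μ_w(a₀ ↔ b) ≤ μ_w(o ↔ b) + Σ_W μ_w(C(o) = W) · μ_w(sel W ↔ b in Wᶜ)`, which is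
`GOOD(w, A, o, b)` at every admissible level (`goodStep24_good_of_engine`, via the closed form
of the goodness functional, `goodStep24_functional_eq`).
For `S = {y}` the hypothesis is `GOOD(G⁰, A, y, b)` with the relay `a₀ = argmin_A μ_{G⁰}(· ↔ b)`
(the induction hypothesis of `stub_goodStep`); for `S = ∅` it is the minimality of `a₀`; for
`|S| ≥ 2` it is the new kernel GLUE-GOOD isolated by this siege seat (companion file
`…GoodStep24Glue.lean`).  No new definitions: the branch weighting appears as the explicit lambda
of `stub_sigmaLaw` with `O = {o}`.
-/

namespace Summit.CriticalPhenomena.PercolationContinuityZ3.Theorems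

open MeasureTheory Set
open Literature.Probability.LatticeModels (prodBernoulli)
open Literature.Probability.Percolation (BondConfig openConn openConnIn openGraph openCluster)
open scoped BigOperators

noncomputable section
open Classical

section GoodStep24EngineAux

open Filter
open Literature.Probability.LatticeModels Literature.Probability.Percolation

variable {n : ℕ}

/-- Gluing a singleton block changes nothing: `glue w {o} = w`. [folklore] -/
theorem goodStep24_glue_singleton (w : Sym2 (Fin n) → unitInterval) (o : Fin n) :
    (fun e : Sym2 (Fin n) =>
      if (∀ x ∈ e, x ∈ ({o} : Finset (Fin n))) ∧ ¬ e.IsDiag then 1 else w e) = w := by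
  funext e
  rw [if_neg]
  rintro ⟨hall, hdiag⟩
  apply hdiag
  induction e using Sym2.ind with
  | h x y =>
    have hx := Finset.mem_singleton.1 (hall x (Sym2.mem_mk_left x y))
    have hy := Finset.mem_singleton.1 (hall y (Sym2.mem_mk_right x y))
    rw [hx, hy]
    exact Sym2.mk_isDiag_iff.2 rfl

/-- The value of the cluster of `o`, read through the connections from `o`:
for `o ∈ W`, `C(o) = W ↔ ∀ x ≠ o, (x ∈ W ↔ o ↔ x)`. [folklore] -/
theorem goodStep24_cluster_eq_iff (ω : BondConfig (Fin n)) (o : Fin n) (W : Finset (Fin n))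
    (hoW : o ∈ W) :
    openCluster ω o = (W : Set (Fin n)) ↔ ∀ x, x ≠ o → (x ∈ W ↔ ω ∈ openConn o x) := by
  constructor
  · intro h x _
    have hx : x ∈ openCluster ω o ↔ x ∈ (W : Set (Fin n)) := by rw [h]
    rw [Finset.mem_coe] at hx
    exact ⟨fun hxW => hx.2 hxW, fun hxC => hx.1 hxC⟩
  · intro h
    ext x
    rw [Finset.mem_coe]
    by_cases hx : x = o
    · subst hx
      exact ⟨fun _ => hoW, fun _ => mem_openCluster_self ω x⟩
    · exact ⟨fun hxC => (h x hx).2 hxC, fun hxW => (h x hx).1 hxW⟩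

/-- **The σ-engine at a single observer, abstract ambient weighting.**  `p` is the ambient law
(in the application `glue w {o} = w`), `hlaw` the layer-decomposition law for the block `{o}`
(`stub_sigmaLaw`), `hpo` says `p` and `w` agree on the pairs leaving `o`, `hker` is the branch
inequality for every admissible layer.  Conclusion: the engine inequality in the ambient `p`.
[cite: KozmaNitzan2024, §3.2 (proofs of Thms 4–5, pp. 13–14)] -/
theorem goodStep24_engine_core (w p : Sym2 (Fin n) → unitInterval) (A : Finset (Fin n))
    (o b a₀ : Fin n) (sel : Finset (Fin n) → Fin n) (hb : b ∈ A) (ho : o ∉ A) (ha₀ : a₀ ∈ A)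
    (hA0 : ∀ a ∈ A, w s(o, a) = 0)
    (hpo : ∀ o' x : Fin n, x ∉ ({o} : Finset (Fin n)) → p s(o', x) = w s(o', x))
    (hlaw : ∀ (S : Finset (Fin n)) (E : Set (BondConfig (Fin n))),
      (prodBernoulli p).real
          ({ω | ∀ x : Fin n, x ∈ S ↔ (x ∉ ({o} : Finset (Fin n)) ∧
              ∃ o' ∈ ({o} : Finset (Fin n)), s(o', x) ∈ ω)} ∩
            {ω | ({e | e ∈ ω ∧ ∀ x ∈ e, x ∉ ({o} : Finset (Fin n))} ∪
              {e | (∀ x ∈ e, x ∈ S) ∧ ¬ e.IsDiag}) ∈ E}) =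
        (prodBernoulli p).real
            {ω | ∀ x : Fin n, x ∈ S ↔ (x ∉ ({o} : Finset (Fin n)) ∧
              ∃ o' ∈ ({o} : Finset (Fin n)), s(o', x) ∈ ω)} *
          (prodBernoulli (fun e : Sym2 (Fin n) =>
            if (∀ x ∈ e, x ∈ S) ∧ ¬ e.IsDiag then 1 else
              if (∃ x ∈ e, x ∈ ({o} : Finset (Fin n))) then 0 else w e)).real E)
    (hker : ∀ S : Finset (Fin n), o ∉ S → Disjoint S A → (∀ y ∈ S, w s(o, y) ≠ 0) →
      (prodBernoulli (fun e : Sym2 (Fin n) =>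
          if (∀ x ∈ e, x ∈ S) ∧ ¬ e.IsDiag then 1 else
            if (∃ x ∈ e, x ∈ ({o} : Finset (Fin n))) then 0 else w e)).real (openConn a₀ b) ≤
        (prodBernoulli (fun e : Sym2 (Fin n) =>
            if (∀ x ∈ e, x ∈ S) ∧ ¬ e.IsDiag then 1 else
              if (∃ x ∈ e, x ∈ ({o} : Finset (Fin n))) then 0 else w e)).real
            (⋃ s ∈ S, openConn s b)
          + ∑ W ∈ (Finset.univ : Finset (Finset (Fin n))).filter (fun W => o ∈ W ∧ Disjoint W A),
              (prodBernoulli (fun e : Sym2 (Fin n) =>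
                  if (∀ x ∈ e, x ∈ S) ∧ ¬ e.IsDiag then 1 else
                    if (∃ x ∈ e, x ∈ ({o} : Finset (Fin n))) then 0 else w e)).real
                  {ω : BondConfig (Fin n) | ∀ x : Fin n, x ≠ o →
                    (x ∈ W ↔ ω ∈ ⋃ s ∈ S, openConn s x)}
                * (prodBernoulli w).real (openConnIn ((W : Set (Fin n))ᶜ) (sel W) b)) :
    (prodBernoulli p).real (openConn a₀ b) ≤
      (prodBernoulli p).real (openConn o b)
        + ∑ W ∈ (Finset.univ : Finset (Finset (Fin n))).filter (fun W => o ∈ W ∧ Disjoint W A),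
            (prodBernoulli p).real {ω : BondConfig (Fin n) | openCluster ω o = (W : Set (Fin n))}
              * (prodBernoulli w).real (openConnIn ((W : Set (Fin n))ᶜ) (sel W) b) := by
  have hbo : b ≠ o := fun h => ho (h ▸ hb)
  have ha₀o : a₀ ≠ o := fun h => ho (h ▸ ha₀)
  have hmemFl : ∀ W, W ∈ (Finset.univ : Finset (Finset (Fin n))).filter
      (fun W => o ∈ W ∧ Disjoint W A) ↔ o ∈ W ∧ Disjoint W A := fun W => by simp
  -- geometry on a layer (the clique condition is vacuous for a singleton block)
  have hclique : ∀ ω : BondConfig (Fin n), ∀ o₁ ∈ ({o} : Finset (Fin n)),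
      ∀ o₂ ∈ ({o} : Finset (Fin n)), o₁ ≠ o₂ → s(o₁, o₂) ∈ ω := by
    intro ω o₁ h₁ o₂ h₂ hne
    exact absurd ((Finset.mem_singleton.1 h₁).trans (Finset.mem_singleton.1 h₂).symm) hne
  -- factorisation of `μ(L_S ∩ F)` for an event `F` that is `Ψ_S⁻¹ F'` on `L_S`
  have hfac : ∀ (S : Finset (Fin n)) (F F' : Set (BondConfig (Fin n))),
      (∀ ω : BondConfig (Fin n),
        (∀ x : Fin n, x ∈ S ↔ (x ∉ ({o} : Finset (Fin n)) ∧
          ∃ o' ∈ ({o} : Finset (Fin n)), s(o', x) ∈ ω)) →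
        (ω ∈ F ↔ ({e | e ∈ ω ∧ ∀ x ∈ e, x ∉ ({o} : Finset (Fin n))} ∪
              {e | (∀ x ∈ e, x ∈ S) ∧ ¬ e.IsDiag}) ∈ F')) →
      (prodBernoulli p).real
          ({ω | ∀ x : Fin n, x ∈ S ↔ (x ∉ ({o} : Finset (Fin n)) ∧
              ∃ o' ∈ ({o} : Finset (Fin n)), s(o', x) ∈ ω)} ∩ F) =
        (prodBernoulli p).real
            {ω | ∀ x : Fin n, x ∈ S ↔ (x ∉ ({o} : Finset (Fin n)) ∧
              ∃ o' ∈ ({o} : Finset (Fin n)), s(o', x) ∈ ω)} *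
          (prodBernoulli (fun e : Sym2 (Fin n) =>
            if (∀ x ∈ e, x ∈ S) ∧ ¬ e.IsDiag then 1 else
              if (∃ x ∈ e, x ∈ ({o} : Finset (Fin n))) then 0 else w e)).real F' := by
    intro S F F' hFF'
    rw [← hlaw S F']
    congr 1
    ext ω
    simp only [Set.mem_inter_iff, Set.mem_setOf_eq]
    exact ⟨fun h => ⟨h.1, (hFF' ω h.1).1 h.2⟩, fun h => ⟨h.1, (hFF' ω h.1).2 h.2⟩⟩
  -- (1) `μ(o ↔ b)` through the star
  have hob : (prodBernoulli p).real (openConn o b) =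
      ∑ S : Finset (Fin n), (prodBernoulli p).real
          {ω | ∀ x : Fin n, x ∈ S ↔ (x ∉ ({o} : Finset (Fin n)) ∧
              ∃ o' ∈ ({o} : Finset (Fin n)), s(o', x) ∈ ω)} *
        (prodBernoulli (fun e : Sym2 (Fin n) =>
            if (∀ x ∈ e, x ∈ S) ∧ ¬ e.IsDiag then 1 else
              if (∃ x ∈ e, x ∈ ({o} : Finset (Fin n))) then 0 else w e)).real
          (⋃ s ∈ S, openConn s b) := by
    rw [sigmaRec_partition p ({o} : Finset (Fin n))]
    refine Finset.sum_congr rfl fun S _ => hfac S _ _ fun ω hLω => ?_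
    have h := (stub_sigmaGeometry n ({o} : Finset (Fin n)) S ω hLω (hclique ω)).1 {b}
      (by simp [hbo.symm])
    simpa only [Finset.set_biUnion_singleton] using h
  -- (2) `μ(a₀ ↔ b)` through the star
  have hab : (prodBernoulli p).real (openConn a₀ b) =
      ∑ S : Finset (Fin n), (prodBernoulli p).real
          {ω | ∀ x : Fin n, x ∈ S ↔ (x ∉ ({o} : Finset (Fin n)) ∧
              ∃ o' ∈ ({o} : Finset (Fin n)), s(o', x) ∈ ω)} *
        (prodBernoulli (fun e : Sym2 (Fin n) =>
            if (∀ x ∈ e, x ∈ S) ∧ ¬ e.IsDiag then 1 else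
              if (∃ x ∈ e, x ∈ ({o} : Finset (Fin n))) then 0 else w e)).real (openConn a₀ b) := by
    rw [sigmaRec_partition p ({o} : Finset (Fin n))]
    refine Finset.sum_congr rfl fun S _ => hfac S _ _ fun ω hLω => ?_
    exact (stub_sigmaGeometry n ({o} : Finset (Fin n)) S ω hLω (hclique ω)).2 a₀ b
      (by simp [ha₀o]) (by simp [hbo])
  -- (3) `μ(C(o) = W)` through the star
  have hCW : ∀ W ∈ (Finset.univ : Finset (Finset (Fin n))).filter (fun W => o ∈ W ∧ Disjoint W A),
      (prodBernoulli p).real {ω : BondConfig (Fin n) | openCluster ω o = (W : Set (Fin n))} =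
      ∑ S : Finset (Fin n), (prodBernoulli p).real
          {ω | ∀ x : Fin n, x ∈ S ↔ (x ∉ ({o} : Finset (Fin n)) ∧
              ∃ o' ∈ ({o} : Finset (Fin n)), s(o', x) ∈ ω)} *
        (prodBernoulli (fun e : Sym2 (Fin n) =>
            if (∀ x ∈ e, x ∈ S) ∧ ¬ e.IsDiag then 1 else
              if (∃ x ∈ e, x ∈ ({o} : Finset (Fin n))) then 0 else w e)).real
          {ω : BondConfig (Fin n) | ∀ x : Fin n, x ≠ o → (x ∈ W ↔ ω ∈ ⋃ s ∈ S, openConn s x)} := by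
    intro W hW
    rw [sigmaRec_partition p ({o} : Finset (Fin n))]
    refine Finset.sum_congr rfl fun S _ => hfac S _ _ fun ω hLω => ?_
    rw [Set.mem_setOf_eq, goodStep24_cluster_eq_iff ω o W ((hmemFl W).1 hW).1, Set.mem_setOf_eq]
    refine forall_congr' fun x => ?_
    refine imp_congr_right fun hx => ?_
    have h := (stub_sigmaGeometry n ({o} : Finset (Fin n)) S ω hLω (hclique ω)).1 {x}
      (by simp [Ne.symm hx])
    simp only [Finset.set_biUnion_singleton] at h
    exact iff_congr Iff.rfl h
  -- positive layers are admissible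
  have hpos : ∀ S : Finset (Fin n), (prodBernoulli p).real
      {ω | ∀ x : Fin n, x ∈ S ↔ (x ∉ ({o} : Finset (Fin n)) ∧
          ∃ o' ∈ ({o} : Finset (Fin n)), s(o', x) ∈ ω)} ≠ 0 →
      o ∉ S ∧ Disjoint S A ∧ ∀ y ∈ S, w s(o, y) ≠ 0 := by
    intro S hS
    have h := sigmaRec_posLayer w p ({o} : Finset (Fin n)) S hpo hS
    refine ⟨fun hoS => (h o hoS).1 (Finset.mem_singleton_self o), ?_, fun y hy => ?_⟩
    · rw [Finset.disjoint_left]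
      intro a haS haA
      obtain ⟨-, o', ho', hne⟩ := h a haS
      rw [Finset.mem_singleton.1 ho'] at hne
      exact hne (hA0 a haA)
    · obtain ⟨-, o', ho', hne⟩ := h y hy
      rw [Finset.mem_singleton.1 ho'] at hne
      exact hne
  -- rewrite the pocket sum through the star and swap the sums
  have hsumC : ∑ W ∈ (Finset.univ : Finset (Finset (Fin n))).filter (fun W => o ∈ W ∧ Disjoint W A),
      (prodBernoulli p).real {ω : BondConfig (Fin n) | openCluster ω o = (W : Set (Fin n))}
        * (prodBernoulli w).real (openConnIn ((W : Set (Fin n))ᶜ) (sel W) b) =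
      ∑ S : Finset (Fin n), (prodBernoulli p).real
          {ω | ∀ x : Fin n, x ∈ S ↔ (x ∉ ({o} : Finset (Fin n)) ∧
              ∃ o' ∈ ({o} : Finset (Fin n)), s(o', x) ∈ ω)} *
        ∑ W ∈ (Finset.univ : Finset (Finset (Fin n))).filter (fun W => o ∈ W ∧ Disjoint W A),
          (prodBernoulli (fun e : Sym2 (Fin n) =>
              if (∀ x ∈ e, x ∈ S) ∧ ¬ e.IsDiag then 1 else
                if (∃ x ∈ e, x ∈ ({o} : Finset (Fin n))) then 0 else w e)).real
              {ω : BondConfig (Fin n) | ∀ x : Fin n, x ≠ o → (x ∈ W ↔ ω ∈ ⋃ s ∈ S, openConn s x)}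
            * (prodBernoulli w).real (openConnIn ((W : Set (Fin n))ᶜ) (sel W) b) := by
    have h1 : ∑ W ∈ (Finset.univ : Finset (Finset (Fin n))).filter (fun W => o ∈ W ∧ Disjoint W A),
        (prodBernoulli p).real {ω : BondConfig (Fin n) | openCluster ω o = (W : Set (Fin n))}
          * (prodBernoulli w).real (openConnIn ((W : Set (Fin n))ᶜ) (sel W) b) =
        ∑ W ∈ (Finset.univ : Finset (Finset (Fin n))).filter (fun W => o ∈ W ∧ Disjoint W A),
          ∑ S : Finset (Fin n), (prodBernoulli p).real
              {ω | ∀ x : Fin n, x ∈ S ↔ (x ∉ ({o} : Finset (Fin n)) ∧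
                  ∃ o' ∈ ({o} : Finset (Fin n)), s(o', x) ∈ ω)} *
            ((prodBernoulli (fun e : Sym2 (Fin n) =>
                if (∀ x ∈ e, x ∈ S) ∧ ¬ e.IsDiag then 1 else
                  if (∃ x ∈ e, x ∈ ({o} : Finset (Fin n))) then 0 else w e)).real
                {ω : BondConfig (Fin n) | ∀ x : Fin n, x ≠ o → (x ∈ W ↔ ω ∈ ⋃ s ∈ S, openConn s x)}
              * (prodBernoulli w).real (openConnIn ((W : Set (Fin n))ᶜ) (sel W) b)) := by
      refine Finset.sum_congr rfl fun W hW => ?_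
      rw [hCW W hW, Finset.sum_mul]
      refine Finset.sum_congr rfl fun S _ => ?_
      ring
    rw [h1, Finset.sum_comm]
    refine Finset.sum_congr rfl fun S _ => ?_
    rw [Finset.mul_sum]
  rw [hab, hob, hsumC, ← Finset.sum_add_distrib]
  refine Finset.sum_le_sum fun S _ => ?_
  rw [← mul_add]
  rcases eq_or_ne ((prodBernoulli p).real
      {ω | ∀ x : Fin n, x ∈ S ↔ (x ∉ ({o} : Finset (Fin n)) ∧
          ∃ o' ∈ ({o} : Finset (Fin n)), s(o', x) ∈ ω)}) 0 with h0 | h0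
  · rw [h0, zero_mul, zero_mul]
  · obtain ⟨hoS, hSA, hSw⟩ := hpos S h0
    exact mul_le_mul_of_nonneg_left (hker S hoS hSA hSw) measureReal_nonneg

/-- From the engine inequality to goodness in selection form: if
`μ_w(a₀ ↔ b) ≤ μ_w(o ↔ b) + Σ_W μ_w(C(o) = W) · μ_w(sel W ↔ b in Wᶜ)` for some `a₀ ∈ A`, then
the goodness functional of `(w, A, o, b)` at the selection `sel` is at most every admissible
level `t` (`1 − t ≤ μ_w(a ↔ b)` on `A`). [cite: KozmaNitzan2024, §3.2 Definition p. 12] -/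
theorem goodStep24_good_of_engine (w : Sym2 (Fin n) → unitInterval) (A : Finset (Fin n))
    (o b a₀ : Fin n) (sel : Finset (Fin n) → Fin n) (hb : b ∈ A) (ha₀ : a₀ ∈ A) (t : ℝ)
    (ht : ∀ a ∈ A, 1 - t ≤ (prodBernoulli w).real (openConn a b))
    (heng : (prodBernoulli w).real (openConn a₀ b) ≤
        (prodBernoulli w).real (openConn o b)
          + ∑ W ∈ (Finset.univ : Finset (Finset (Fin n))).filter (fun W => o ∈ W ∧ Disjoint W A),
              (prodBernoulli w).real {ω : BondConfig (Fin n) | openCluster ω o = (W : Set (Fin n))}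
                * (prodBernoulli w).real (openConnIn ((W : Set (Fin n))ᶜ) (sel W) b)) :
    (prodBernoulli w).real ((⋃ a ∈ A, openConn o a) ∩ (openConn o b)ᶜ)
      + ∑ W ∈ (Finset.univ : Finset (Finset (Fin n))).filter (fun W => o ∈ W ∧ Disjoint W A),
          (prodBernoulli w).real {ω : BondConfig (Fin n) | openCluster ω o = (W : Set (Fin n))}
            * (prodBernoulli w).real (openConnIn ((W : Set (Fin n))ᶜ) (sel W) b)ᶜ
      ≤ t := by
  rw [goodStep24_functional_eq w A o b hb sel]
  linarith [ht a₀ ha₀]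

end GoodStep24EngineAux

open Filter Literature.Probability.LatticeModels Literature.Probability.Percolation in
/-- Registered helper stub `stub_goodStepEngine_k24` of crux stmt-CriticalPhenomena-4576 (siege k24,
for `stub_goodStep`): **the σ-engine at a low-only observer** — the two-point functions of `G`
through the star of `o` in closed form, and the resulting reduction of goodness to the glued
goodness of the branch graphs `G⁰/S` with a FIXED relay `a₀`.  Hypotheses: `b ∈ A ∌ o`, every pair
`o–a` (`a ∈ A`) of weight `0`, `a₀ ∈ A`, and for every layer candidate `S` (`o ∉ S`,
`Disjoint S A`, all `w(o–y) ≠ 0` on `S`) the branch inequality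
`μ'(a₀ ↔ b) ≤ μ'(S ↔ b) + Σ_{W ∋ o, W ∩ A = ∅} μ'{∀ x ≠ o, x ∈ W ↔ S ↔ x} · μ_w(sel W ↔ b in Wᶜ)`
for `μ' = prodBernoulli (G⁰/S)` (the star of `o` killed, `S` glued — the explicit lambda of
`stub_sigmaLaw` with `O = {o}`).  Conclusion:
`μ_w(a₀ ↔ b) ≤ μ_w(o ↔ b) + Σ_W μ_w(C(o) = W) · μ_w(sel W ↔ b in Wᶜ)`.
[cite: KozmaNitzan2024, §3.2 (proofs of Thms 4–5, pp. 13–14: the `σ_B`-decomposition)] -/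
theorem stub_goodStepEngine_k24 :
    ∀ (n : ℕ) (w : Sym2 (Fin n) → unitInterval) (A : Finset (Fin n)) (o b a₀ : Fin n)
      (sel : Finset (Fin n) → Fin n),
      b ∈ A → o ∉ A → a₀ ∈ A → (∀ a ∈ A, w s(o, a) = 0) →
      (∀ S : Finset (Fin n), o ∉ S → Disjoint S A → (∀ y ∈ S, w s(o, y) ≠ 0) →
        (prodBernoulli (fun e : Sym2 (Fin n) =>
            if (∀ x ∈ e, x ∈ S) ∧ ¬ e.IsDiag then 1 else
              if (∃ x ∈ e, x ∈ ({o} : Finset (Fin n))) then 0 else w e)).real (openConn a₀ b) ≤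
          (prodBernoulli (fun e : Sym2 (Fin n) =>
              if (∀ x ∈ e, x ∈ S) ∧ ¬ e.IsDiag then 1 else
                if (∃ x ∈ e, x ∈ ({o} : Finset (Fin n))) then 0 else w e)).real
              (⋃ s ∈ S, openConn s b)
            + ∑ W ∈ (Finset.univ : Finset (Finset (Fin n))).filter (fun W => o ∈ W ∧ Disjoint W A),
                (prodBernoulli (fun e : Sym2 (Fin n) =>
                    if (∀ x ∈ e, x ∈ S) ∧ ¬ e.IsDiag then 1 else
                      if (∃ x ∈ e, x ∈ ({o} : Finset (Fin n))) then 0 else w e)).real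
                    {ω : BondConfig (Fin n) | ∀ x : Fin n, x ≠ o →
                      (x ∈ W ↔ ω ∈ ⋃ s ∈ S, openConn s x)}
                  * (prodBernoulli w).real (openConnIn ((W : Set (Fin n))ᶜ) (sel W) b)) →
      (prodBernoulli w).real (openConn a₀ b) ≤
        (prodBernoulli w).real (openConn o b)
          + ∑ W ∈ (Finset.univ : Finset (Finset (Fin n))).filter (fun W => o ∈ W ∧ Disjoint W A),
              (prodBernoulli w).real {ω : BondConfig (Fin n) | openCluster ω o = (W : Set (Fin n))}
                * (prodBernoulli w).real (openConnIn ((W : Set (Fin n))ᶜ) (sel W) b) := by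
  intro n w A o b a₀ sel hb ho ha₀ hA0 hker
  have hpo : ∀ o' x : Fin n, x ∉ ({o} : Finset (Fin n)) →
      (fun e : Sym2 (Fin n) =>
        if (∀ y ∈ e, y ∈ ({o} : Finset (Fin n))) ∧ ¬ e.IsDiag then 1 else w e) s(o', x) =
        w s(o', x) := by
    intro o' x hx
    show (if (∀ y ∈ s(o', x), y ∈ ({o} : Finset (Fin n))) ∧ ¬ (s(o', x)).IsDiag
      then (1 : unitInterval) else w s(o', x)) = w s(o', x)
    rw [if_neg]
    rintro ⟨h, -⟩
    exact hx (h x (Sym2.mem_mk_right o' x))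
  have core := goodStep24_engine_core w
    (fun e : Sym2 (Fin n) =>
      if (∀ y ∈ e, y ∈ ({o} : Finset (Fin n))) ∧ ¬ e.IsDiag then 1 else w e)
    A o b a₀ sel hb ho ha₀ hA0 hpo (fun S E => stub_sigmaLaw n w {o} S E) hker
  rw [goodStep24_glue_singleton w o] at core
  exact core

end

end Summit.CriticalPhenomena.PercolationContinuityZ3.Theorems
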